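import Mathlib
import Literature.RingTheory.TwoVariableSeries.Basic
import Summits.ResolutionOfSingularities.ResolutionOfSingularities.Theorems.WeightedInvariantLocalWeightedDropMonicDescentGraphCurveTools
import Summits.ResolutionOfSingularities.ResolutionOfSingularities.Theorems.WeightedInvariantLocalWeightedDropMonicDescentShearNewton
import Summits.ResolutionOfSingularities.ResolutionOfSingularities.Theorems.WeightedInvariantLocalWeightedDropMonicDescentTransportLaws

/-!
# `WeightedInvariant.LocalWeightedDrop`, sub-stub N4″: `2β` IS NON-INCREASING ALONG THE STRATEGY Σ** (first half of T-5′)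

Crux item stmt-ResolutionOfSingularities-8899 `LocalWeightedDrop` (route `ResolutionOfSingularities/WeightedInvariant`), door
`WeightedConstruction` stmt-ResolutionOfSingularities-0571.  [OURS · L1 W4.3, chain w43, lead prover; first half of piece T-5′ (`stub_monicDescentNoChain`)
of `N4PRIME-PLAN.md`.  MODEL: Cossart–Jannsen–Saito LNM 2270 Prop. 13.5 ("`β_{x_q} ≤ β_x`") together with Lemma 13.4 (3) (`β′ < β` at `(0:1)` when
quasi-isolated) and the curve blow-ups — here for the positional strategy Σ** (`MonicDescent.succLabels`) on well-prepared reduced positions.]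

`betaL_succLabels_le`: conditional on T-1′ (well-preparing re-centrings exist), for a well-prepared reduced position `A` and every successor label
`A′ ∈ succLabels A`: `2β(A′) ≤ 2β(A)`, and EQUALITY forces the step to be one of the `β`-neutral ones — the blow-up of the permissible axis curve
`V(y,u₁)` (`divOneLabel`), or a point move answered by `(1:0)` (`blowOneLabel A`) or by `(1:λ)` (`blowOneLabel (prep (shearLabel (C λ) A))`).
Hence along any Σ**-chain `2β` is eventually constant and the tail consists of those steps only (input of the limit-label argument, T-5′ second half).
Ingredients (all landed): exact Newton-set transports (`newtonSet_blowOne/_blowTwo/_divOne/_divTwo`), the invariant laws (`betaL_image_psi_le`,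
`betaL_image_phi`, `betaL_image_shiftOne/Two`), CJS 13.6 for labels (`betaL_shear_eq`), CJS 11.4 for labels (`betaL_recentre_eq`), and the row
transfer (`isPermissibleTwo_prep_shear`).
-/

set_option linter.dupNamespace false -- mandated namespace of this single-conjunct summit

noncomputable section

namespace Summit.ResolutionOfSingularities.ResolutionOfSingularities.Theorems

namespace MonicDescent

open MvPowerSeries Literature.RingTheory.TwoVariableSeries

variable {k : Type} [Field k]

/-- For a position every point of the scaled Newton set has `P₀ + P₁ ≥ 3`. -/
theorem three_le_sum_of_isPosition {A₀ A₁ : MvPowerSeries (Fin 2) k} (hA : IsPosition A₀ A₁) :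
    ∀ P ∈ newtonSet A₀ A₁, 3 ≤ P 0 + P 1 := by
  obtain ⟨h₀, h₁⟩ := hA
  have hdeg : ∀ Q : Fin 2 →₀ ℕ, Finsupp.degree Q = Q 0 + Q 1 := by
    intro Q
    rw [Finsupp.degree_eq_sum]
    simp [Fin.sum_univ_two]
  rintro P (hP | ⟨e, rfl, he⟩)
  · by_contra hlt
    push Not at hlt
    apply hP
    apply coeff_of_lt_order
    refine lt_of_le_of_lt ?_ h₀
    rw [hdeg]
    exact_mod_cast (by omega : P 0 + P 1 ≤ 2)
  · by_contra hlt
    push Not at hlt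
    simp only [Finsupp.smul_apply, smul_eq_mul] at hlt
    apply he
    apply coeff_of_lt_order
    refine lt_of_le_of_lt ?_ h₁
    rw [hdeg]
    exact_mod_cast (by omega : e 0 + e 1 ≤ 1)

/-- For a position every point of the scaled Newton set has `P₀ + P₁ ≥ 2`. -/
theorem two_le_sum_of_isPosition {A₀ A₁ : MvPowerSeries (Fin 2) k} (hA : IsPosition A₀ A₁) :
    ∀ P ∈ newtonSet A₀ A₁, 2 ≤ P 0 + P 1 :=
  fun P hP => le_trans (by norm_num) (three_le_sum_of_isPosition hA P hP)

/-- If `V(y,u₁)` is permissible, every point of the scaled Newton set has `P₀ ≥ 2`. -/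
theorem two_le_fst_of_isPermissibleOne {A₀ A₁ : MvPowerSeries (Fin 2) k} (h : IsPermissibleOne A₀ A₁) :
    ∀ P ∈ newtonSet A₀ A₁, 2 ≤ P 0 := by
  rintro P (hP | ⟨e, rfl, he⟩)
  · exact h.1 P hP
  · have := h.2 e he
    simp only [Finsupp.smul_apply, smul_eq_mul]
    omega

/-- If `V(y,u₂)` is permissible, every point of the scaled Newton set has `P₁ ≥ 2`. -/
theorem two_le_snd_of_isPermissibleTwo {A₀ A₁ : MvPowerSeries (Fin 2) k} (h : IsPermissibleTwo A₀ A₁) :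
    ∀ P ∈ newtonSet A₀ A₁, 2 ≤ P 1 := by
  rintro P (hP | ⟨e, rfl, he⟩)
  · exact h.1 P hP
  · have := h.2 e he
    simp only [Finsupp.smul_apply, smul_eq_mul]
    omega

/-- If `V(y,u₁)` is NOT permissible, some point of the scaled Newton set has `P₀ ≤ 1`, so `2α ≤ 1`. -/
theorem alphaL_le_one_of_not_isPermissibleOne {A₀ A₁ : MvPowerSeries (Fin 2) k} (h : ¬ IsPermissibleOne A₀ A₁) :
    alphaL (newtonSet A₀ A₁) ≤ 1 := by
  simp only [IsPermissibleOne, not_and_or, not_forall, not_le, exists_prop] at h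
  rcases h with ⟨d, hd, hlt⟩ | ⟨d, hd, hlt⟩
  · exact le_trans (alphaL_le (Or.inl hd)) (by omega)
  · have := alphaL_le (N := newtonSet A₀ A₁) (P := 2 • d) (Or.inr ⟨d, rfl, hd⟩)
    simp only [Finsupp.smul_apply, smul_eq_mul] at this
    omega

variable [CharP k 2]

/-- The prepared sheared label keeps `2α` and `2β` and its lex-min point: for a well-prepared label `A` with non-empty Newton set and a
well-preparing re-centring `ψ` of `shearLabel h A`. -/
theorem alphaL_betaL_prep_shear {A₀ A₁ h ψ : MvPowerSeries (Fin 2) k} (hWP : WellPrepared A₀ A₁) (hne : (newtonSet A₀ A₁).Nonempty)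
    (hprep : IsPrepRecentring (shear h A₀) (shear h A₁) ψ) :
    alphaL (newtonSet (recentre ψ (shear h A₀) (shear h A₁)).1 (recentre ψ (shear h A₀) (shear h A₁)).2) = alphaL (newtonSet A₀ A₁) ∧
    betaL (newtonSet (recentre ψ (shear h A₀) (shear h A₁)).1 (recentre ψ (shear h A₀) (shear h A₁)).2) = betaL (newtonSet A₀ A₁) ∧
    (newtonSet (recentre ψ (shear h A₀) (shear h A₁)).1 (recentre ψ (shear h A₀) (shear h A₁)).2).Nonempty := by
  have hαS := alphaL_shear_eq h A₀ A₁ hne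
  have hβS := betaL_shear_eq h A₀ A₁ hne
  -- the lex-min point of `A` is the lex-min point of the sheared label, and it is odd
  obtain ⟨P, hP, hP0, hP1⟩ := exists_eq_betaL hne
  have hPodd : IsOdd A₀ A₁ P := hWP P (isVertex_lexMin hP hP0 hP1)
  have hPS : P ∈ newtonSet (shear h A₀) (shear h A₁) := (newtonSet_shear_col h A₀ A₁ hP0.le).mpr hP
  have hPoddS : IsOdd (shear h A₀) (shear h A₁) P := (isOdd_shear_iff_of_col h A₀ A₁ hP0.le).mpr hPodd
  have hP0S : P 0 = alphaL (newtonSet (shear h A₀) (shear h A₁)) := by rw [hαS]; exact hP0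
  have hP1S : P 1 = betaL (newtonSet (shear h A₀) (shear h A₁)) := by rw [hβS]; exact hP1
  refine ⟨?_, ?_, ?_⟩
  · rw [alphaL_recentre_eq hprep hPS hP0S hP1S hPoddS, hαS]
  · rw [betaL_recentre_eq hprep hPS hP0S hP1S hPoddS, hβS]
  · obtain ⟨-, -, -, hpers⟩ := hprep
    exact ⟨P, (hpers P (isVertex_lexMin hPS hP0S hP1S) hPoddS).1.1⟩

/-- `2β` IS NON-INCREASING ALONG Σ** (conditional on T-1′), and the `β`-neutral steps are exactly: the blow-up of the permissible `V(y,u₁)`, or a point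
move answered by `(1:0)` or `(1:λ)`.  (CJS Prop. 13.5 + Lemma 13.4 (3) for the positional strategy on well-prepared reduced positions.) -/
theorem betaL_succLabels_le
    (hT1 : ∀ (k : Type) [Field k] [CharP k 2] [IsAlgClosed k] (A₀ A₁ : MvPowerSeries (Fin 2) k),
      IsPosition A₀ A₁ → ∃ ψ : MvPowerSeries (Fin 2) k, IsPrepRecentring A₀ A₁ ψ)
    [IsAlgClosed k] (A : Label k) (hWP : WellPrepared A.1 A.2) (hpos : IsPosition A.1 A.2) (hred : ¬ IsDoublePlane A.1 A.2)
    (A' : Label k) (hA' : A' ∈ succLabels A) :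
    betaL (newtonSet A'.1 A'.2) ≤ betaL (newtonSet A.1 A.2) ∧
    (betaL (newtonSet A'.1 A'.2) = betaL (newtonSet A.1 A.2) →
      (IsPermissibleOne A.1 A.2 ∧ A' = divOneLabel A) ∨
      (¬ IsPermissibleOne A.1 A.2 ∧ ¬ IsPermissibleTwo A.1 A.2 ∧ ¬ HasGraphCurve A ∧
        (A' = blowOneLabel A ∨ ∃ c : k, c ≠ 0 ∧ A' = blowOneLabel (prep (shearLabel (C c) A))))) := by
  have hne : (newtonSet A.1 A.2).Nonempty := newtonSet_nonempty_of_not_isDoublePlane hred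
  have hsum := two_le_sum_of_isPosition hpos
  have hsum3 := three_le_sum_of_isPosition hpos
  unfold succLabels at hA'
  by_cases h1 : IsPermissibleOne A.1 A.2
  · -- (a′) blow up `V(y,u₁)`: `β′ = β`
    rw [if_pos h1] at hA'
    rcases hA' with rfl
    have hfst := two_le_fst_of_isPermissibleOne h1
    have hN : newtonSet (divOneLabel A).1 (divOneLabel A).2 = shiftOne '' newtonSet A.1 A.2 := newtonSet_divOne A.1 A.2 hfst
    rw [hN, betaL_image_shiftOne hfst hne]
    exact ⟨le_rfl, fun _ => Or.inl ⟨h1, rfl⟩⟩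
  rw [if_neg h1] at hA'
  by_cases h2 : IsPermissibleTwo A.1 A.2
  · -- (a′) blow up `V(y,u₂)`: `β′ = β − 2 < β`
    rw [if_pos h2] at hA'
    rcases hA' with rfl
    have hsnd := two_le_snd_of_isPermissibleTwo h2
    have hN : newtonSet (divTwoLabel A).1 (divTwoLabel A).2 = shiftTwo '' newtonSet A.1 A.2 := newtonSet_divTwo A.1 A.2 hsnd
    rw [hN, betaL_image_shiftTwo hsnd hne]
    obtain ⟨P, hP, hP0, hP1⟩ := exists_eq_betaL hne
    have hβ2 : 2 ≤ betaL (newtonSet A.1 A.2) := by rw [← hP1]; exact hsnd P hP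
    exact ⟨by omega, fun h => by omega⟩
  rw [if_neg h2] at hA'
  by_cases h3 : HasGraphCurve A
  · -- (a″) shear, prepare, blow up `V(y, ũ₂)`: `β′ = β − 2 < β`
    rw [if_pos h3] at hA'
    rcases hA' with rfl
    set h := graphShear A with hh
    have hspec : ∃ ψ' : MvPowerSeries (Fin 2) k, (∀ e : Fin 2 →₀ ℕ, e 1 ≠ 0 → coeff e h = 0) ∧ constantCoeff ψ' = 0 ∧
        IsPermissibleTwo (recentre ψ' (shear h A.1) (shear h A.2)).1 (recentre ψ' (shear h A.1) (shear h A.2)).2 := by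
      obtain ⟨h', ψ', hh', hψ', hperm⟩ := h3
      exact Classical.epsilon_spec (p := fun h : MvPowerSeries (Fin 2) k => ∃ ψ : MvPowerSeries (Fin 2) k,
        (∀ e : Fin 2 →₀ ℕ, e 1 ≠ 0 → coeff e h = 0) ∧ constantCoeff ψ = 0 ∧
        IsPermissibleTwo (recentre ψ (shear h A.1) (shear h A.2)).1 (recentre ψ (shear h A.1) (shear h A.2)).2) ⟨h', ψ', hh', hψ', hperm⟩
    obtain ⟨ψ', -, -, hperm⟩ := hspec
    have hposS : IsPosition (shear h A.1) (shear h A.2) := isPosition_shearLabel h hpos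
    have hprep : IsPrepRecentring (shear h A.1) (shear h A.2) (prepPsi (shear h A.1) (shear h A.2)) :=
      isPrepRecentring_prepPsi (hT1 k _ _ hposS)
    have hpermB := isPermissibleTwo_prep_shear hperm hprep
    obtain ⟨hαB, hβB, hneB⟩ := alphaL_betaL_prep_shear (h := h) hWP hne hprep
    set B : Label k := prep (shearLabel h A) with hB
    have hsndB : ∀ P ∈ newtonSet B.1 B.2, 2 ≤ P 1 := two_le_snd_of_isPermissibleTwo hpermB
    have hneB' : (newtonSet B.1 B.2).Nonempty := hneB
    have hβB' : betaL (newtonSet B.1 B.2) = betaL (newtonSet A.1 A.2) := hβB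
    have hN : newtonSet (divTwoLabel B).1 (divTwoLabel B).2 = shiftTwo '' newtonSet B.1 B.2 := newtonSet_divTwo B.1 B.2 hsndB
    obtain ⟨P, hP, hP0, hP1⟩ := exists_eq_betaL hneB'
    have hβ2 : 2 ≤ betaL (newtonSet A.1 A.2) := by rw [← hβB', ← hP1]; exact hsndB P hP
    rw [hN, betaL_image_shiftTwo hsndB hneB', hβB']
    exact ⟨by omega, fun h => by omega⟩
  rw [if_neg h3] at hA'
  -- (b) the point move
  have hα1 : alphaL (newtonSet A.1 A.2) ≤ 1 := alphaL_le_one_of_not_isPermissibleOne h1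
  rcases hA' with (rfl | rfl) | ⟨c, hc, rfl⟩
  · -- (1:0): `β′ = γ⁻ ≤ β`
    have hN : newtonSet (blowOneLabel A).1 (blowOneLabel A).2 = psi 2 '' newtonSet A.1 A.2 := newtonSet_blowOne A.1 A.2 hsum
    rw [hN]
    exact ⟨betaL_image_psi_le hsum hne, fun _ => Or.inr ⟨h1, h2, h3, Or.inl rfl⟩⟩
  · -- (0:1): `β′ = α + β − 2 < β` since `2α ≤ 1`
    have hN : newtonSet (blowTwoLabel A).1 (blowTwoLabel A).2 = phi '' newtonSet A.1 A.2 := newtonSet_blowTwo A.1 A.2 hsum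
    rw [hN, betaL_image_phi hsum hne]
    obtain ⟨P, hP, hP0, hP1⟩ := exists_eq_betaL hne
    have h3P := hsum3 P hP
    rw [hP0, hP1] at h3P
    exact ⟨by omega, fun h => by omega⟩
  · -- (1:λ): shear by `λ`, prepare, `(1:0)`: `β′ = γ⁻(prepared) ≤ β`
    have hposS : IsPosition (shear (C c) A.1) (shear (C c) A.2) := isPosition_shearLabel (C c) hpos
    have hprep : IsPrepRecentring (shear (C c) A.1) (shear (C c) A.2) (prepPsi (shear (C c) A.1) (shear (C c) A.2)) :=
      isPrepRecentring_prepPsi (hT1 k _ _ hposS)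
    obtain ⟨hαB, hβB, hneB⟩ := alphaL_betaL_prep_shear (h := C c) hWP hne hprep
    set B : Label k := prep (shearLabel (C c) A) with hB
    have hposB : IsPosition B.1 B.2 := hprep.2.1
    have hsumB := two_le_sum_of_isPosition hposB
    have hneB' : (newtonSet B.1 B.2).Nonempty := hneB
    have hβB' : betaL (newtonSet B.1 B.2) = betaL (newtonSet A.1 A.2) := hβB
    have hN : newtonSet (blowOneLabel B).1 (blowOneLabel B).2 = psi 2 '' newtonSet B.1 B.2 := newtonSet_blowOne B.1 B.2 hsumB
    refine ⟨?_, fun _ => Or.inr ⟨h1, h2, h3, Or.inr ⟨c, hc, rfl⟩⟩⟩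
    rw [hN]
    exact le_trans (betaL_image_psi_le hsumB hneB') hβB'.le

end MonicDescent

end Summit.ResolutionOfSingularities.ResolutionOfSingularities.Theorems

end
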